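import Mathlib
import HarnessLib
import Summits.RiemannHypothesis.RiemannHypothesis.Theorems.DbrWallAntipersistenceLadder
import Summits.RiemannHypothesis.RiemannHypothesis.Theorems.DbrWallAntipersistenceLogTwo

/-!
# DBR column, rung B-P(P1): the GENERIC RUNG KIT for the anti-persistence ladder (analysis half)

RH-FREE calculus lemmas (LINE 1 of the label discipline) about the closed form (1.1) of Suzuki's screw function
`Ψ = Literature.NumberTheory.LFunctions.zetaScrew`; NOT worded as, and not, progress toward RH («`Ψ(2s) < 2Ψ(s)`
for all `s > 0`» stays a conjecture from data; its `∀ s` form is RH-IMPLIED, not claimed).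

The rungs `…LogTwo` … `…LogTwentyFive` of the ladder (`Ψ(2s) < 2Ψ(s)` for `0 < s ≤ (log q')/2`, one rational
certificate per half-log-prime-power `(log q')/2`) were each a hand-written ~600-line pair of files. This module makes
the step `(log q)/2 → (log q')/2` GENERIC in the consecutive prime powers `q < q'`:

* `primeSumA N = Σ_{n ≤ N} Λ(n)/√n`, `primeSumB N = Σ_{n ≤ N} Λ(n) log n/√n` and `zetaScrewPrimeSum_eq_affine`:
  `φ(t) = t·A(q) − B(q)` for `log q ≤ t ≤ log q'` when no prime power lies strictly between `q` and `q'`;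
* `vonMangoldt_eq_zero_of_coprime_mul` (`Λ(ab) = 0` for coprime `a, b > 1`) and the `decide`-able witnesses
  `coprimeWitness`, `noPrimePowBetween` (kernel-checkable lists of coprime factorisations);
* `two_mul_zetaScrew_sub_shape`: on the piece `[(log q)/2, (log q')/2]` the two-point gap has the ladder shape
  `D(t) + (log 2/√2)(2t − log 2) + (αt + β)` with `α, β` explicit in `A, B` (`m` = largest prime power with `m² ≤ q`);
* `exp_log_div_four_bounds_of` (`q'^{1/4}` from `a⁴ ≤ q' ≤ b⁴`), `exp_neg_lam_mul_half_log` and the generic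
  archimedean lower bound `gap_half_log_ge`: `D((log q')/2) ≥ Σ_{k<20}(1 − q'^{−(k+1)}c)²/λ'_k² + (1 − q'^{−21})²/85 − 4(b−1)²`
  for any `c ≥ q'^{−1/4}`, `b ≥ q'^{1/4}` — the twenty-term-plus-telescoping-tail bound of every earlier rung, once.

The certificate half (log-table lookups, prime-term lower bound, the one-line rung theorem) is `DbrWallRungCert`.
Nothing here bears on the truth of RH. References: M. Suzuki, J. Lond. Math. Soc. (2) 108 (2023) = arXiv:2206.03682,
(1.1) [Suzuki2023]. -/

set_option linter.dupNamespace false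

noncomputable section

open scoped BigOperators
open Set
namespace Summit.RiemannHypothesis.RiemannHypothesis.Theorems.DbrWall

open Literature.NumberTheory.LFunctions

/-! ### Prime sums as affine functions between consecutive prime powers -/

/-- `A(N) = Σ_{1 ≤ n ≤ N} Λ(n) n^{−1/2}` (slope of the prime sum `φ` past `log N`). [cite: Suzuki2023, (1.1)] -/
def primeSumA (N : ℕ) : ℝ :=
  ∑ n ∈ Finset.Icc 1 N, ArithmeticFunction.vonMangoldt n / Real.sqrt n

/-- `B(N) = Σ_{1 ≤ n ≤ N} Λ(n) n^{−1/2} log n` (intercept of the prime sum `φ` past `log N`). [cite: Suzuki2023, (1.1)] -/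
def primeSumB (N : ℕ) : ℝ :=
  ∑ n ∈ Finset.Icc 1 N, ArithmeticFunction.vonMangoldt n / Real.sqrt n * Real.log n

/-- **`φ` is affine between consecutive prime powers**: if `Λ(n) = 0` for all `q < n < q'`, then
`φ(t) = t·A(q) − B(q)` for every `log q ≤ t ≤ log q'`. [folklore] -/
theorem zetaScrewPrimeSum_eq_affine {q q' : ℕ} {t : ℝ} (hq : 1 ≤ q) (hqq' : q ≤ q')
    (hqt : Real.log q ≤ t) (htq' : t ≤ Real.log q')
    (hgap : ∀ n : ℕ, q < n → n < q' → ArithmeticFunction.vonMangoldt n = 0) :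
    zetaScrewPrimeSum t = t * primeSumA q - primeSumB q := by
  have hq1 : (1 : ℝ) ≤ q := by exact_mod_cast hq
  have hq'0 : (0 : ℝ) < q' := by exact_mod_cast (show 0 < q' by omega)
  have ht0 : 0 ≤ t := (Real.log_nonneg hq1).trans hqt
  have hM : Real.exp |t| ≤ ((q' : ℕ) : ℝ) := by
    rw [abs_of_nonneg ht0]
    calc Real.exp t ≤ Real.exp (Real.log q') := Real.exp_le_exp.2 htq'
      _ = q' := Real.exp_log hq'0
  have hI : ∀ N : ℕ, Finset.Icc 1 N = Finset.Ioc 0 N := fun N ↦ by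
    ext n; simp only [Finset.mem_Icc, Finset.mem_Ioc]; omega
  rw [zetaScrewPrimeSum_eq_sum_max hM, abs_of_nonneg ht0, hI,
    ← Finset.sum_Ioc_consecutive _ (Nat.zero_le q) hqq']
  have hzero : ∑ n ∈ Finset.Ioc q q', ArithmeticFunction.vonMangoldt n / Real.sqrt n
      * max (t - Real.log n) 0 = 0 := by
    refine Finset.sum_eq_zero fun n hn ↦ ?_
    rw [Finset.mem_Ioc] at hn
    rcases lt_or_eq_of_le hn.2 with hlt | heq
    · rw [hgap n hn.1 hlt, zero_div, zero_mul]
    · rw [heq, max_eq_right (sub_nonpos.2 htq'), mul_zero]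
  rw [hzero, add_zero, primeSumA, primeSumB, hI, Finset.mul_sum, ← Finset.sum_sub_distrib]
  refine Finset.sum_congr rfl fun n hn ↦ ?_
  rw [Finset.mem_Ioc] at hn
  have hn0 : (0 : ℝ) < n := by exact_mod_cast hn.1
  have hlog : Real.log n ≤ t :=
    (Real.log_le_log hn0 (by exact_mod_cast hn.2)).trans hqt
  rw [max_eq_left (sub_nonneg.2 hlog)]
  ring

/-! ### Kernel-checkable absence of prime powers -/

/-- `Λ(ab) = 0` when `a, b > 1` are coprime (a prime power has no coprime factorisation). [folklore] -/
theorem vonMangoldt_eq_zero_of_coprime_mul {n a b : ℕ} (hab : a * b = n) (ha : 1 < a) (hb : 1 < b)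
    (hco : Nat.gcd a b = 1) : ArithmeticFunction.vonMangoldt n = 0 := by
  rw [ArithmeticFunction.vonMangoldt_eq_zero_iff]
  intro hpp
  obtain ⟨p, k, hp, hk, hpk⟩ := (isPrimePow_nat_iff n).1 hpp
  have hadvd : a ∣ p ^ k := by rw [hpk, ← hab]; exact dvd_mul_right a b
  have hbdvd : b ∣ p ^ k := by rw [hpk, ← hab]; exact dvd_mul_left b a
  obtain ⟨i, -, hi⟩ := (Nat.dvd_prime_pow hp).1 hadvd
  obtain ⟨j, -, hj⟩ := (Nat.dvd_prime_pow hp).1 hbdvd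
  have hi0 : i ≠ 0 := by rintro rfl; rw [pow_zero] at hi; omega
  have hj0 : j ≠ 0 := by rintro rfl; rw [pow_zero] at hj; omega
  have hdvd : p ∣ Nat.gcd a b := by
    rw [hi, hj]; exact Nat.dvd_gcd (dvd_pow_self p hi0) (dvd_pow_self p hj0)
  rw [hco] at hdvd
  exact hp.one_lt.ne' (Nat.dvd_one.1 hdvd)

/-- Kernel-checkable witness that `n` is NOT a prime power: some `(a, b)` in the list with `ab = n`, `a, b > 1`,
`gcd(a, b) = 1`. [folklore] -/
def coprimeWitness (n : ℕ) (L : List (ℕ × ℕ)) : Bool :=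
  L.any fun ab => decide (ab.1 * ab.2 = n ∧ 1 < ab.1 ∧ 1 < ab.2 ∧ Nat.gcd ab.1 ab.2 = 1)

/-- Soundness of `coprimeWitness`: `Λ(n) = 0`. [folklore] -/
theorem vonMangoldt_eq_zero_of_coprimeWitness {n : ℕ} {L : List (ℕ × ℕ)}
    (h : coprimeWitness n L = true) : ArithmeticFunction.vonMangoldt n = 0 := by
  obtain ⟨ab, -, hab⟩ := List.any_eq_true.1 h
  rw [decide_eq_true_eq] at hab
  exact vonMangoldt_eq_zero_of_coprime_mul hab.1 hab.2.1 hab.2.2.1 hab.2.2.2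

/-- Kernel-checkable «no prime power strictly between `q` and `q'`»: every `q < n < q'` has a coprime
factorisation in the list. [folklore] -/
def noPrimePowBetween (q q' : ℕ) (L : List (ℕ × ℕ)) : Bool :=
  (List.range' (q + 1) (q' - q - 1)).all fun n => coprimeWitness n L

/-- Soundness of `noPrimePowBetween`: `Λ(n) = 0` for all `q < n < q'`. [folklore] -/
theorem vonMangoldt_eq_zero_of_noPrimePowBetween {q q' : ℕ} {L : List (ℕ × ℕ)}
    (h : noPrimePowBetween q q' L = true) :
    ∀ n : ℕ, q < n → n < q' → ArithmeticFunction.vonMangoldt n = 0 := by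
  intro n h1 h2
  have hmem : n ∈ List.range' (q + 1) (q' - q - 1) := by rw [List.mem_range'_1]; omega
  exact vonMangoldt_eq_zero_of_coprimeWitness ((List.all_eq_true.1 h) n hmem)

/-! ### The shape of the two-point gap on a piece `[(log q)/2, (log q')/2]` -/

/-- **Shape lemma, generic**: let `q ≤ q'` and `m ≤ m'` be such that no prime power lies strictly between `q` and
`q'` nor strictly between `m` and `m'`, with `m² ≤ q` and `q' ≤ m'²` (`m ≥ 1`). Then for `(log q)/2 ≤ t ≤ (log q')/2`,
`2Ψ(t) − Ψ(2t) = D(t) + (log 2/√2)(2t − log 2) + (αt + β)` with `α = 2A(q) − 2A(m) − 2·log 2/√2`,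
`β = 2B(m) − B(q) + (log 2/√2)·log 2`. [folklore] -/
theorem two_mul_zetaScrew_sub_shape {q q' m m' : ℕ} (hm : 1 ≤ m) (hmm' : m ≤ m') (hqq' : q ≤ q')
    (hmq : m * m ≤ q) (hq'm' : q' ≤ m' * m')
    (hgq : ∀ n : ℕ, q < n → n < q' → ArithmeticFunction.vonMangoldt n = 0)
    (hgm : ∀ n : ℕ, m < n → n < m' → ArithmeticFunction.vonMangoldt n = 0)
    (t : ℝ) (h0 : Real.log q / 2 ≤ t) (h1 : t ≤ Real.log q' / 2) :
    2 * zetaScrew t - zetaScrew (2 * t) =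
      (∑' k : ℕ, (1 - Real.exp (-((2 * (k : ℝ) + 5 / 2) * t))) ^ 2 / (2 * (k : ℝ) + 5 / 2) ^ 2)
      - 4 * (Real.exp (t / 2) - 1) ^ 2 + Real.log 2 / Real.sqrt 2 * (2 * t - Real.log 2)
      + ((2 * primeSumA q - 2 * primeSumA m - 2 * (Real.log 2 / Real.sqrt 2)) * t
        + (2 * primeSumB m - primeSumB q + Real.log 2 / Real.sqrt 2 * Real.log 2)) := by
  have hm1 : (1 : ℝ) ≤ m := by exact_mod_cast hm
  have hm0 : (0 : ℝ) < m := by linarith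
  have hq1 : 1 ≤ q := le_trans (Nat.one_le_iff_ne_zero.2 (by nlinarith)) hmq
  have hlogm : Real.log m ≤ t := by
    have h2 : 2 * Real.log m = Real.log ((m * m : ℕ) : ℝ) := by
      push_cast; rw [Real.log_mul hm0.ne' hm0.ne']; ring
    have h3 : Real.log ((m * m : ℕ) : ℝ) ≤ Real.log q :=
      Real.log_le_log (by positivity) (by exact_mod_cast hmq)
    linarith
  have hm'0 : (0 : ℝ) < m' := by exact_mod_cast (show 0 < m' by omega)
  have hlogm' : t ≤ Real.log m' := by
    have h2 : 2 * Real.log m' = Real.log ((m' * m' : ℕ) : ℝ) := by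
      push_cast; rw [Real.log_mul hm'0.ne' hm'0.ne']; ring
    have hq'0 : (0 : ℝ) < q' := by exact_mod_cast (show 0 < q' by omega)
    have h3 : Real.log q' ≤ Real.log ((m' * m' : ℕ) : ℝ) :=
      Real.log_le_log hq'0 (by exact_mod_cast hq'm')
    linarith
  have ht0 : 0 ≤ t := (Real.log_nonneg hm1).trans hlogm
  rw [two_mul_zetaScrew_sub_eq_gap_add_primeSums ht0,
    zetaScrewPrimeSum_eq_affine hq1 hqq' (by linarith) (by linarith) hgq,
    zetaScrewPrimeSum_eq_affine hm hmm' hlogm hlogm' hgm]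
  ring

/-! ### The archimedean gap at `(log q')/2`: generic twenty-term lower bound -/

/-- `r := e^{(log q')/4} = q'^{1/4}`: `r⁴ = q'`. [folklore] -/
theorem exp_log_div_four_pow_four {q' : ℕ} (hq' : 1 ≤ q') :
    Real.exp (Real.log q' / 4) ^ 4 = q' := by
  have hq'0 : (0 : ℝ) < q' := by exact_mod_cast hq'
  rw [← Real.exp_nat_mul, show ((4 : ℕ) : ℝ) * (Real.log q' / 4) = Real.log q' by push_cast; ring,
    Real.exp_log hq'0]

/-- `q'^{1/4}` from rational fourth-power brackets: `a ≤ r` whenever `a⁴ ≤ q'`, and `r ≤ b` whenever `q' ≤ b⁴`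
(`b ≥ 0`). [folklore] -/
theorem exp_log_div_four_bounds_of {q' : ℕ} (hq' : 1 ≤ q') {a b : ℝ} (hb : 0 ≤ b)
    (ha4 : a ^ 4 ≤ q') (hb4 : (q' : ℝ) ≤ b ^ 4) :
    a ≤ Real.exp (Real.log q' / 4) ∧ Real.exp (Real.log q' / 4) ≤ b := by
  set r := Real.exp (Real.log q' / 4) with hr
  have hr0 : 0 < r := Real.exp_pos _
  have hr4 : r ^ 4 = q' := exp_log_div_four_pow_four hq'
  refine ⟨?_, ?_⟩
  · by_contra h
    push Not at h
    have h4 : r ^ 4 < a ^ 4 := pow_lt_pow_left₀ h hr0.le (by norm_num)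
    linarith
  · by_contra h
    push Not at h
    have h4 : b ^ 4 < r ^ 4 := pow_lt_pow_left₀ h hb (by norm_num)
    linarith

/-- `1 ≤ q'^{1/4}`. [folklore] -/
theorem one_le_exp_log_div_four {q' : ℕ} (hq' : 1 ≤ q') : 1 ≤ Real.exp (Real.log q' / 4) :=
  Real.one_le_exp (div_nonneg (Real.log_nonneg (by exact_mod_cast hq')) (by norm_num))

/-- The gap exponentials at `s₁ = (log q')/2`: `e^{−λ'_k s₁} = q'^{−(k+1)}·q'^{−1/4}`. [folklore] -/
theorem exp_neg_lam_mul_half_log {q' : ℕ} (hq' : 1 ≤ q') (k : ℕ) :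
    Real.exp (-((2 * (k : ℝ) + 5 / 2) * (Real.log q' / 2)))
      = (1 / (q' : ℝ)) ^ (k + 1) * (Real.exp (Real.log q' / 4))⁻¹ := by
  set r := Real.exp (Real.log q' / 4) with hr
  have hr4 : r ^ 4 = q' := exp_log_div_four_pow_four hq'
  have h1 : Real.exp (-((2 * (k : ℝ) + 5 / 2) * (Real.log q' / 2))) = r⁻¹ ^ (4 * k + 5) := by
    rw [show (2 * (k : ℝ) + 5 / 2) * (Real.log q' / 2) = ((4 * k + 5 : ℕ) : ℝ) * (Real.log q' / 4) by
      push_cast; ring, Real.exp_neg, Real.exp_nat_mul, inv_pow]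
  have h2 : r⁻¹ ^ (4 * k + 5) = (r⁻¹ ^ 4) ^ (k + 1) * r⁻¹ := by ring
  have h3 : r⁻¹ ^ 4 = 1 / q' := by rw [inv_pow, hr4, one_div]
  rw [h1, h2, h3]

/-- **Generic archimedean lower bound at `(log q')/2`**: for `c ≥ q'^{−1/4}` (`0 ≤ c ≤ 1`) and `b ≥ q'^{1/4}`,
`Σ_{k<20}(1 − q'^{−(k+1)}c)²/λ'_k² + (1 − q'^{−21})²/85 − 4(b − 1)² ≤ D((log q')/2)`
(`λ'_k = 2k + 5/2`; twenty terms, then the telescoping tail `Σ_{k≥20} λ'_k⁻² ≥ 1/85`). [folklore] -/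
theorem gap_half_log_ge {q' : ℕ} (hq' : 2 ≤ q') {c b : ℝ} (hc0 : 0 ≤ c) (hc1 : c ≤ 1)
    (hrc : (Real.exp (Real.log q' / 4))⁻¹ ≤ c) (hrb : Real.exp (Real.log q' / 4) ≤ b) :
    (∑ k ∈ Finset.range 20, (1 - (1 / (q' : ℝ)) ^ (k + 1) * c) ^ 2 / (2 * (k : ℝ) + 5 / 2) ^ 2)
      + (1 - (1 / (q' : ℝ)) ^ 21) ^ 2 / 85 - 4 * (b - 1) ^ 2 ≤
    (∑' k : ℕ, (1 - Real.exp (-((2 * (k : ℝ) + 5 / 2) * (Real.log q' / 2)))) ^ 2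
        / (2 * (k : ℝ) + 5 / 2) ^ 2)
      - 4 * (Real.exp (Real.log q' / 2 / 2) - 1) ^ 2 := by
  have hq'1 : 1 ≤ q' := by omega
  set r := Real.exp (Real.log q' / 4) with hr
  have hr0 : 0 < r := Real.exp_pos _
  have hq1' : (1 : ℝ) ≤ q' := by exact_mod_cast hq'1
  have hr1 : 1 ≤ r := one_le_exp_log_div_four hq'1
  have hrinv1 : r⁻¹ ≤ 1 := inv_le_one_of_one_le₀ hr1
  have hrinv0 : 0 ≤ r⁻¹ := by positivity
  have hs0 : (0 : ℝ) ≤ Real.log q' / 2 := by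
    have := Real.log_nonneg hq1'; positivity
  have hiq0 : (0 : ℝ) ≤ 1 / q' := by positivity
  have hiq1 : (1 : ℝ) / q' ≤ 1 := by rw [div_le_one (by positivity)]; exact hq1'
  rw [show Real.log q' / 2 / 2 = Real.log q' / 4 by ring]
  simp only [exp_neg_lam_mul_half_log hq'1]
  have hS : Summable fun k : ℕ =>
      (1 - (1 / (q' : ℝ)) ^ (k + 1) * r⁻¹) ^ 2 / (2 * (k : ℝ) + 5 / 2) ^ 2 := by
    have := summable_gap_terms hs0
    simp only [exp_neg_lam_mul_half_log hq'1] at this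
    exact this
  rw [← hS.sum_add_tsum_nat_add 20]
  have hterm : ∀ k : ℕ, (1 - (1 / (q' : ℝ)) ^ (k + 1) * c) ^ 2 / (2 * (k : ℝ) + 5 / 2) ^ 2
      ≤ (1 - (1 / (q' : ℝ)) ^ (k + 1) * r⁻¹) ^ 2 / (2 * (k : ℝ) + 5 / 2) ^ 2 := by
    intro k
    apply div_le_div_of_nonneg_right _ (by positivity)
    have hp0 : 0 ≤ (1 / (q' : ℝ)) ^ (k + 1) := by positivity
    have hp1 : (1 / (q' : ℝ)) ^ (k + 1) ≤ 1 := pow_le_one₀ hiq0 hiq1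
    have hlo : 0 ≤ 1 - (1 / (q' : ℝ)) ^ (k + 1) * c := by nlinarith [mul_le_mul hp1 hc1 hc0 zero_le_one]
    have hle : 1 - (1 / (q' : ℝ)) ^ (k + 1) * c ≤ 1 - (1 / (q' : ℝ)) ^ (k + 1) * r⁻¹ := by
      nlinarith [mul_le_mul_of_nonneg_left hrc hp0]
    exact pow_le_pow_left₀ hlo hle 2
  have hhead : (∑ k ∈ Finset.range 20, (1 - (1 / (q' : ℝ)) ^ (k + 1) * c) ^ 2 / (2 * (k : ℝ) + 5 / 2) ^ 2)
      ≤ ∑ k ∈ Finset.range 20, (1 - (1 / (q' : ℝ)) ^ (k + 1) * r⁻¹) ^ 2 / (2 * (k : ℝ) + 5 / 2) ^ 2 :=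
    Finset.sum_le_sum fun k _ => hterm k
  have hT := Literature.Probability.LatticeModels.hasSum_telescope (show (0 : ℝ) < 85 / 4 by norm_num)
  have hTs : Summable fun k : ℕ =>
      (1 - (1 / (q' : ℝ)) ^ 21) ^ 2 / 4 * (1 / (((k : ℝ) + 85 / 4) * ((k : ℝ) + 85 / 4 + 1))) :=
    (hT.mul_left _).summable
  have hTval : ∑' k : ℕ, (1 - (1 / (q' : ℝ)) ^ 21) ^ 2 / 4 * (1 / (((k : ℝ) + 85 / 4) * ((k : ℝ) + 85 / 4 + 1)))
      = (1 - (1 / (q' : ℝ)) ^ 21) ^ 2 / 4 * (1 / (85 / 4)) := (hT.mul_left _).tsum_eq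
  have htail : ∑' k : ℕ, (1 - (1 / (q' : ℝ)) ^ 21) ^ 2 / 4 * (1 / (((k : ℝ) + 85 / 4) * ((k : ℝ) + 85 / 4 + 1)))
      ≤ ∑' k : ℕ, (1 - (1 / (q' : ℝ)) ^ (k + 20 + 1) * r⁻¹) ^ 2 / (2 * ((k + 20 : ℕ) : ℝ) + 5 / 2) ^ 2 := by
    refine hTs.tsum_le_tsum (fun k => ?_) ((summable_nat_add_iff 20).2 hS)
    have hq0 : 0 ≤ (1 / (q' : ℝ)) ^ (k + 20 + 1) * r⁻¹ := by positivity
    have hq1 : (1 / (q' : ℝ)) ^ (k + 20 + 1) * r⁻¹ ≤ (1 / (q' : ℝ)) ^ 21 := by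
      have h1 : (1 / (q' : ℝ)) ^ (k + 20 + 1) ≤ (1 / (q' : ℝ)) ^ 21 :=
        pow_le_pow_of_le_one hiq0 hiq1 (by omega)
      have h2 : (1 / (q' : ℝ)) ^ (k + 20 + 1) * r⁻¹ ≤ (1 / (q' : ℝ)) ^ (k + 20 + 1) * 1 :=
        mul_le_mul_of_nonneg_left hrinv1 (by positivity)
      linarith
    have hnum0 : 0 ≤ 1 - (1 / (q' : ℝ)) ^ 21 := by linarith [pow_le_one₀ (n := 21) hiq0 hiq1]
    have hnum1 : (1 - (1 / (q' : ℝ)) ^ 21) ^ 2 ≤ (1 - (1 / (q' : ℝ)) ^ (k + 20 + 1) * r⁻¹) ^ 2 :=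
      pow_le_pow_left₀ hnum0 (by linarith) 2
    have hk : (0 : ℝ) ≤ k := Nat.cast_nonneg k
    have hden : (2 * ((k + 20 : ℕ) : ℝ) + 5 / 2) ^ 2 ≤ 4 * (((k : ℝ) + 85 / 4) * ((k : ℝ) + 85 / 4 + 1)) := by
      push_cast; nlinarith
    have hden0 : 0 < (2 * ((k + 20 : ℕ) : ℝ) + 5 / 2) ^ 2 := by positivity
    rw [show (1 - (1 / (q' : ℝ)) ^ 21) ^ 2 / 4 * (1 / (((k : ℝ) + 85 / 4) * ((k : ℝ) + 85 / 4 + 1)))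
        = (1 - (1 / (q' : ℝ)) ^ 21) ^ 2 / (4 * (((k : ℝ) + 85 / 4) * ((k : ℝ) + 85 / 4 + 1))) by
      field_simp]
    exact div_le_div₀ (by positivity) hnum1 hden0 hden
  rw [hTval] at htail
  have htailv : (1 - (1 / (q' : ℝ)) ^ 21) ^ 2 / 4 * (1 / (85 / 4)) = (1 - (1 / (q' : ℝ)) ^ 21) ^ 2 / 85 := by
    ring
  rw [htailv] at htail
  have hsub : 4 * (r - 1) ^ 2 ≤ 4 * (b - 1) ^ 2 := by nlinarith
  linarith

end Summit.RiemannHypothesis.RiemannHypothesis.Theorems.DbrWall
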